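import Summits.Ventures.CertifiedManyBodySolver.Downfold.BoxesNdNiO2E
import Summits.Ventures.CertifiedManyBodySolver.Downfold.ParameterBoxRebase
import HarnessLib

/-!
# The NdNiO₂ OBJECT-M uncertainty LADDER, typed: printed one-band MEMBERS (exact rationals, page-ref provenance) → direct
# HULLS → inflated RUNGS → the object-M ROWS OF RECORD of box #20 (column M21), with the quotient rows `U/t`, `r₁`, `V/t`, `J`

Venture CertifiedManyBodySolver, cell `pub/hubbard-downfold` (MO-S1; D-0154 (1)(C) COVERAGE, material (iii) NdNiO₂), seat hubbard-cov-ndnio2-unc-1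
(`prover-hubbard-cov-ndnio2-unc-1-0`), lane «object M» by the lead's RULING R-ma (STATUS 2026-08-28T05:18Z; object E = unc-2's
`BoxesNdNiO2ELadder.lean`, filling/dsd = unc-3's `BoxesNdNiO2FillingLadder.lean`); namespace `Summit.Ventures.CertifiedManyBodySolver.Downfold`.
SOURCE OF EVERY NUMBER: `router/BOXES/NdNiO2.md` (sha16 `a02e41a7b870a485`, BOX OF RECORD #20): run-8 §DFT-1b v1 (2026-08-26T18:52Z), the lead's
§OF-RECORD v1 / v1.2 (R-B4) / v1.5 (R-ac) / v1.7 (R-ak), run-8 §R-ac FOLD v1, mod-4 §REDUCTION-B v0, lit-2 §LIT-PREVIEW v1/v1.1. OBJECT M = the one-band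
MLWF Hamiltonian truncated at printed range (`t, t′/t, t″/t, t⊥/t`), as opposed to object E (the `t–t′` refit; `Downfold/BoxesNdNiO2E.lean`).

TYPING POLICY. A literature MEMBER is the exact rational quotient of the PRINTED primaries when the source prints a pair (Been 2021 Tab. I,
Nd column: `t[1,0,0] = −0.374, t[1,1,0] = 0.094, t[2,0,0] = −0.043, t[0,0,1] = −0.033` eV ⇒ `t′/t = −94/374`, …; Kitatani 2020 p. 3: `t, t′, t″, t_z =
395, −95, 47, 34` meV; Nomura 2019 Tab. III: `t = 0.370 / 0.375` (two codes), `t′ = 0.092, t″ = −0.045, V_a = 0.218 / 0.223, U = 2.578 / 2.608` eV), else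
the printed decimal; an in-house member is the box file's printed 4-decimal value with its job id. Members of one coordinate are a `List ℚ` whose
docstring lists provenance IN ORDER; hulls / rungs / rows are `Entry.ofEnds` with the box's PRINTED ends; every `∈` below is then a kernel check of
the box's arithmetic and rounding — three printed ends that do NOT enclose an admitted member are typed as `¬ Mem` facts (§2, §3, §4: 4th/3rd-decimal
inward prints; an ASK to the lead, never an edit here). Every literature number is [float] at source; typing makes the rational exact, not the physics.

* §1 `t` (eV): members → direct hull `[0.3689, 0.395]` → v1 rung `[0.343, 0.433]` → with technique-B `t_B ∈ [0.326, 0.345]` (R-B4) the ROW `[0.32, 0.433]`.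
* §2 `t′/t`: members → direct hull → FLOOR rung `[−0.291, −0.190]` → INFL-3to1 `±0.08` ROW `[−0.321, −0.160]` (midpoint `−0.2402 ± 0.08` typed).
* §3 `t″/t` ROW `[0.066, 0.167]`, `t⊥/t` ROW `[0.041, 0.088]` (uniform `t_z`; the antinodal `k_z` object `1.3 t` is a printed caveat, not a row).
* §4 quotients: `U_abs` hull `[2.47, 3.2]` eV (members typed by unc-2) ÷ `t` ⇒ direct `[6.25, 8.68]`, ROW `[5.82, 9.8]`; `r₁ = U/W₁ ∈ [0.789, 1.04] ≥ 3/5`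
  (the «1BH» word-bearing inequality, margin typed); `V/t`; `J = 4t²/U ∈ [0.170, 0.253]` eV vs RIXS `0.0641 ± 0.0034` (MODEL-FORM warning `≥ 2.5×`).
* The typed object-M BOX `boxNdNiO2M_M21` assembled from these rows (+ the kinematic energy-word shape and the «MOS2-ndnio2-M21» planning arithmetic)
  is the companion file `Downfold/BoxesNdNiO2M.lean`.

Everything is PROVED (definitions with bodies; no `sorry`). HONEST FRAMING: S1's SYSTEMATIC (screening-grade) box typed verbatim; typing certifies that
admitted members sit in printed rows and that printed quotient rows enclose the quotients — nothing about NdNiO₂; no word, hull or box is edited here;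
the MODEL-FORM notes of record (one-band `t′` is not a dpσ property; `J` inconsistency ×2.5–3; antinode `k_z` 1.3 t; self-doped reservoir) travel
with the box as text; no phase sentence; no summit statement is proved by this file.
-/

noncomputable section

namespace Summit.Ventures.CertifiedManyBodySolver.Downfold

open NonemptyInterval Literature.MathematicalPhysics.QuantumLattice
  Literature.MathematicalPhysics.QuantumLattice.ThermodynamicLimit

/-! ## §0 Two helpers -/

/-- A rational between the printed ends is a member of the printed entry. [folklore] -/
theorem Entry.mem_ofEnds_of_rat {lo hi : ℚ} {h : lo ≤ hi} {g : Grade} {m : ℚ} (h₁ : lo ≤ m) (h₂ : m ≤ hi) :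
    (Entry.ofEnds lo hi h g).Mem (m : ℝ) := by
  rw [Entry.mem_ofEnds_iff]; exact ⟨by exact_mod_cast h₁, by exact_mod_cast h₂⟩

/-- Interval division with positive denominators: `a ≤ U ≤ b`, `c ≤ t ≤ d`, `0 ≤ a`, `0 < c` ⇒ `a/d ≤ U/t ≤ b/c` (BOX-SCHEMA `divPos`). [folklore] -/
theorem divPos_bounds {a b c d U t : ℝ} (ha : 0 ≤ a) (hc : 0 < c) (hU : a ≤ U ∧ U ≤ b) (ht : c ≤ t ∧ t ≤ d) :
    a / d ≤ U / t ∧ U / t ≤ b / c := by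
  have ht0 : 0 < t := hc.trans_le ht.1
  have hb0 : 0 ≤ b := (ha.trans hU.1).trans hU.2
  constructor
  · calc a / d ≤ a / t := div_le_div_of_nonneg_left ha ht0 ht.2
      _ ≤ U / t := div_le_div_of_nonneg_right hU.1 ht0.le
  · calc U / t ≤ b / t := div_le_div_of_nonneg_right hU.2 ht0.le
      _ ≤ b / c := div_le_div_of_nonneg_left hb0 hc ht.1

/-! ## §1 `t` (eV), object M — MLWF one-band nearest-neighbour hopping -/

/-- **`t` members (eV), direct one-band MLWF determinations, in order**: (1) `0.3689` WAN:j257807 run-8 p0 (La-proxy, bulk cell, QE 7.5 PBE,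
no frozen window); (2) `0.3749` WAN:j257812 run-8 sto leg (film-clamped `a = 3.905 Å`, INFL-STRUCT); (3) `0.370` and (4) `0.375` Nomura et al. PRB 100
205138 (2019) arXiv:1909.03942 Tab. III (NdNiO₂, Nd-4f in core; two codes; same-paper pairs `U/|t| = 2.608/0.370 = 7.05`, `2.578/0.375 = 6.87`);
(5) `0.374` Been et al. PRX 11 011050 (2021) arXiv:2002.12300 Tab. I, Nd column `t[1,0,0] = −0.374`; (6) `0.395` Kitatani et al. npj QM 5 59 (2020)
arXiv:2002.12230 p. 3 (`t = 395` meV, one-orbital projection). [folklore] -/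
def ndNiO2M_t_members : List ℚ := [3689/10000, 3749/10000, 370/1000, 375/1000, 374/1000, 395/1000]

/-- **Direct hull of the `t` members**: `[0.3689, 0.395]` eV (§DFT-1b v1 «hull [0.3689, 0.395]»). [folklore] -/
def ndNiO2M_t_direct : Entry := Entry.ofEnds (3689/10000) (395/1000) (by norm_num) .screening

/-- **Technique-B members `t_B` (eV)** (mod-4 §REDUCTION-B v0, kit j259131, maps E | F | W of four dpσ sets; R-B4: ADMITTED to the object-M `t` hull), in
order: run-8 p0 `0.328 / 0.328 / 0.335`; sto `0.333 / 0.333 / 0.340`; sr20 (x = 0.2) `0.337 / 0.337 / 0.345`; LIT Botana–Norman 2020 arXiv:1908.10946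
Tab. II LaNiO₂ set `0.326 / 0.326 / 0.332`. [folklore] -/
def ndNiO2M_tB_members : List ℚ :=
  [328/1000, 328/1000, 335/1000, 333/1000, 333/1000, 340/1000, 337/1000, 337/1000, 345/1000, 326/1000, 326/1000, 332/1000]

/-- **Hull of the technique-B members**: `t_B ∈ [0.326, 0.345]` eV (R-B4). [folklore] -/
def ndNiO2M_tB_hull : Entry := Entry.ofEnds (326/1000) (345/1000) (by norm_num) .screening

/-- **Rung v1** (§OF-RECORD v1): direct hull ⊕ FLOOR(t) ±8 % ⊕ INFL-T +3 % (hi) ⊕ provisional INFL-3to1 ±10 % ⇒ `[0.343, 0.433]` eV. [folklore] -/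
def ndNiO2M_t_v1 : Entry := Entry.ofEnds (343/1000) (433/1000) (by norm_num) .screening

/-- **`t_eV (M)` ROW OF RECORD** (§OF-RECORD v1.2, R-B4: lower edge `t_B` 0.326 − INFL-T ⇒ 0.32; upper edge never shrinks): `[0.32, 0.433]` eV. [folklore] -/
def ndNiO2M_t : Entry := Entry.ofEnds (8/25) (433/1000) (by norm_num) .screening

/-- Every `t` member lies in the direct hull. [folklore] -/
theorem ndNiO2M_t_members_mem_direct : ∀ m ∈ ndNiO2M_t_members, ndNiO2M_t_direct.Mem (m : ℝ) := by
  intro m hm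
  simp only [ndNiO2M_t_members, List.mem_cons, List.not_mem_nil, or_false] at hm
  rcases hm with rfl | rfl | rfl | rfl | rfl | rfl <;> exact Entry.mem_ofEnds_of_rat (by norm_num) (by norm_num)

/-- Every technique-B member lies in the `t_B` hull. [folklore] -/
theorem ndNiO2M_tB_members_mem_hull : ∀ m ∈ ndNiO2M_tB_members, ndNiO2M_tB_hull.Mem (m : ℝ) := by
  intro m hm
  simp only [ndNiO2M_tB_members, List.mem_cons, List.not_mem_nil, or_false] at hm
  rcases hm with rfl | rfl | rfl | rfl | rfl | rfl | rfl | rfl | rfl | rfl | rfl | rfl <;>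
    exact Entry.mem_ofEnds_of_rat (by norm_num) (by norm_num)

/-- **The ladder is monotone**: direct hull ⊆ v1 rung ⊆ row of record, and the `t_B` hull ⊆ row of record. [folklore] -/
theorem ndNiO2M_t_ladder :
    (∀ x, ndNiO2M_t_direct.Mem x → ndNiO2M_t_v1.Mem x) ∧ (∀ x, ndNiO2M_t_v1.Mem x → ndNiO2M_t.Mem x) ∧
      (∀ x, ndNiO2M_tB_hull.Mem x → ndNiO2M_t.Mem x) :=
  ⟨fun _ hx => Entry.mem_ofEnds_mono (by norm_num) (by norm_num) hx,
    fun _ hx => Entry.mem_ofEnds_mono (by norm_num) (by norm_num) hx,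
    fun _ hx => Entry.mem_ofEnds_mono (by norm_num) (by norm_num) hx⟩

/-- **CONTEXT `t` values (not hull members by any ruling; each still inside the ROW)**, in order: ref-1 La-proxy cutoff replay REF:j256777 `0.3705` (basis of the
router line); Held et al. Front. Phys. 9 810394 (2022) arXiv:2201.01220 Tab. 3 NdNiO₂ `0.3945` (1-band) / `0.3976` (10-band; OUTSIDE the direct hull by 0.0026,
inside the row); run-8 doped / bulk columns WAN:j263329 sr10 `0.3741`, WAN:j257052 sr20 `0.3829`, WAN:j264356 sr25 `0.3876`, WAN:j287892 li20 `0.3855` /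
wa20 `0.3842` (M279 bulk); Hirayama–Nomura–Arita arXiv:2202.03661 Tab. 3 «YNiO₂»@LDA `0.357` (4f-free proxy at the LaNiO₂ lattice); run-8 3-orbital block
`0.373` (fit not converged). [folklore] -/
def ndNiO2M_t_context : List ℚ :=
  [3705/10000, 3945/10000, 3976/10000, 3741/10000, 3829/10000, 3876/10000, 3855/10000, 3842/10000, 357/1000, 373/1000]

/-- Every context `t` value lies in the row of record `[0.32, 0.433]`. [folklore] -/
theorem ndNiO2M_t_context_mem_row : ∀ m ∈ ndNiO2M_t_context, ndNiO2M_t.Mem (m : ℝ) := by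
  intro m hm
  simp only [ndNiO2M_t_context, List.mem_cons, List.not_mem_nil, or_false] at hm
  rcases hm with rfl | rfl | rfl | rfl | rfl | rfl | rfl | rfl | rfl | rfl <;> exact Entry.mem_ofEnds_of_rat (by norm_num) (by norm_num)

/-! ## §2 `t′/t`, object M -/

/-- **`t′/t` members, in order**: (1) `−0.2308` WAN:j257807 p0; (2) `−0.2291` WAN:j257812 sto; (3) `−95/395` Kitatani 2020 p. 3 (`t′ = −95`, `t = 395` meV;
printed −0.2405); (4) `−92/370` Nomura 2019 Tab. III (`t′ = 0.092`, `t = −0.370`; printed −0.2486); (5) `−94/374` Been 2021 Tab. I Nd (`0.094 / −0.374`;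
printed −0.2513). Cuprate-like sign throughout. [folklore] -/
def ndNiO2M_tp_members : List ℚ := [-2308/10000, -2291/10000, -95/395, -92/370, -94/374]

/-- **Direct hull of the `t′/t` members, exact least enclosure** `[−94/374, −0.2291]` (printed «hull [−0.2513, −0.2291]»: the 4-decimal print of
`−94/374 = −0.251337` is inward by `3.7·10⁻⁵`, see `ndNiO2M_tp_printedHull_inward`). [folklore] -/
def ndNiO2M_tp_direct : Entry := Entry.ofEnds (-94/374) (-2291/10000) (by norm_num) .screening

/-- **FLOOR rung** (§DFT-1b v1: FLOOR(tp/t) ±0.05 as minimum half-width around the midpoint −0.2402 ⇒ printed `[−0.291, −0.190]`). [folklore] -/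
def ndNiO2M_tp_floor : Entry := Entry.ofEnds (-291/1000) (-19/100) (by norm_num) .screening

/-- **`tp/t (M)` ROW OF RECORD** (§OF-RECORD v1: provisional INFL-3to1 ±0.08 ⇒ `[−0.321, −0.160]`). [folklore] -/
def ndNiO2M_tp : Entry := Entry.ofEnds (-321/1000) (-4/25) (by norm_num) .screening

/-- Every `t′/t` member lies in the exact direct hull. [folklore] -/
theorem ndNiO2M_tp_members_mem_direct : ∀ m ∈ ndNiO2M_tp_members, ndNiO2M_tp_direct.Mem (m : ℝ) := by
  intro m hm
  simp only [ndNiO2M_tp_members, List.mem_cons, List.not_mem_nil, or_false] at hm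
  rcases hm with rfl | rfl | rfl | rfl | rfl <;> exact Entry.mem_ofEnds_of_rat (by norm_num) (by norm_num)

/-- ROUNDING NOTE (immaterial, inside every floor): the printed 4-decimal hull end `−0.2513` does NOT enclose the exact Been quotient `−94/374`; it misses by
less than `4·10⁻⁵`. [folklore] -/
theorem ndNiO2M_tp_printedHull_inward : (-94/374 : ℚ) < -2513/10000 ∧ (-2513/10000 : ℚ) - (-94/374) < 4/100000 := by
  constructor <;> norm_num

/-- **The ladder is monotone**: direct hull ⊆ FLOOR rung ⊆ row of record. [folklore] -/
theorem ndNiO2M_tp_ladder :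
    (∀ x, ndNiO2M_tp_direct.Mem x → ndNiO2M_tp_floor.Mem x) ∧ (∀ x, ndNiO2M_tp_floor.Mem x → ndNiO2M_tp.Mem x) :=
  ⟨fun _ hx => Entry.mem_ofEnds_mono (by norm_num) (by norm_num) hx,
    fun _ hx => Entry.mem_ofEnds_mono (by norm_num) (by norm_num) hx⟩

/-- **The INFL-3to1 construction reproduced**: every real within `0.08` of the printed direct-hull midpoint `−0.2402` lies in the row of record. [folklore] -/
theorem ndNiO2M_tp_mem_of_abs_sub_mid_le {x : ℝ} (hx : |x - (-0.2402)| ≤ 0.08) : ndNiO2M_tp.Mem x := by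
  rw [abs_le] at hx
  refine (Entry.mem_ofEnds_iff _ _ _ _ _).2 ⟨?_, ?_⟩ <;> push_cast <;> linarith [hx.1, hx.2]

/-- **CONTEXT `t′/t` values** (inside the ROW, not hull members), in order: run-8 doped / bulk columns sr10 `−0.226`, sr20 `−0.217`, sr25 `−0.235`, li20/wa20 `−0.217`
(M22/M59/M60/M279: «parent intervals reused, INFL-dop within FLOOR»); Held 2022 Tab. 3 NdNiO₂ `−0.242 / −0.239`; Hirayama 2022 Tab. 3 «YNiO₂»@LDA `−0.26`;
Botana–Norman 2020 Tab. I LaNiO₂ `t₂/t₁ = 92/−368`; run-8 3-orbital block `−0.26`. NOT in the row (MODEL-FORM note of record, R-B4): the dpσ technique-B ratio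
`t′_B/t_B ∈ [−0.10, −0.074]` — «the nickelate's large one-band t′ is NOT a dpσ property» (`ndNiO2M_tp_techniqueB_not_mem`). [folklore] -/
def ndNiO2M_tp_context : List ℚ := [-226/1000, -217/1000, -235/1000, -242/1000, -239/1000, -26/100, -92/368]

/-- Every context `t′/t` value lies in the row of record. [folklore] -/
theorem ndNiO2M_tp_context_mem_row : ∀ m ∈ ndNiO2M_tp_context, ndNiO2M_tp.Mem (m : ℝ) := by
  intro m hm
  simp only [ndNiO2M_tp_context, List.mem_cons, List.not_mem_nil, or_false] at hm
  rcases hm with rfl | rfl | rfl | rfl | rfl | rfl | rfl <;> exact Entry.mem_ofEnds_of_rat (by norm_num) (by norm_num)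

/-- The technique-B (dpσ) `t′/t` reading `−0.086` is NOT a member of the one-band row (the MODEL-FORM note of record, kernel side). [folklore] -/
theorem ndNiO2M_tp_techniqueB_not_mem : ¬ ndNiO2M_tp.Mem ((-86/1000 : ℚ) : ℝ) := by
  intro h
  have h' := ((Entry.mem_ofEnds_iff _ _ _ _ _).1 h).2
  exact absurd h' (by norm_num)

/-! ## §3 `t″/t` and `t⊥/t` (uniform `t_z/t`), object M -/

/-- **`t″/t` members, in order**: `0.1121` WAN:j257807 p0; `0.1120` WAN:j257812 sto; `47/395` Kitatani 2020 p. 3 (printed 0.119); `45/370` Nomura 2019 Tab. III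
(printed 0.1216); `43/374` Been 2021 Tab. I (printed 0.115). Sign structure as in cuprates (`t″ = −H(2a,0) > 0`). [folklore] -/
def ndNiO2M_tpp_members : List ℚ := [1121/10000, 1120/10000, 47/395, 45/370, 43/374]

/-- **`tpp/t (M)` ROW OF RECORD** `[0.066, 0.167]` (printed hull `[0.112, 0.1216]`, midpoint ± FLOOR(tpp/t) 0.05). [folklore] -/
def ndNiO2M_tpp : Entry := Entry.ofEnds (33/500) (167/1000) (by norm_num) .screening

/-- Every `t″/t` member lies in the row of record (the exact Nomura quotient `45/370 = 0.12162…` exceeds the printed 4-decimal hull end `0.1216` by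
`2·10⁻⁵` — immaterial; the ROW encloses it). [folklore] -/
theorem ndNiO2M_tpp_members_mem_row : ∀ m ∈ ndNiO2M_tpp_members, ndNiO2M_tpp.Mem (m : ℝ) := by
  intro m hm
  simp only [ndNiO2M_tpp_members, List.mem_cons, List.not_mem_nil, or_false] at hm
  rcases hm with rfl | rfl | rfl | rfl | rfl <;> exact Entry.mem_ofEnds_of_rat (by norm_num) (by norm_num)

/-- **`t⊥/t` members (uniform `t_z/t`), in order**: `0.0422` WAN:j257807 p0; `0.0418` WAN:j257812 sto; `34/395` Kitatani 2020 p. 3 (`t_z = 34` meV «negligibly small»;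
printed 0.086 / 0.0861); `33/374` Been 2021 Tab. I Nd `t[0,0,1] = −0.033` (printed 0.088 / 0.0882). La-proxy (ours) vs f-in-core literature differ ×2 ⇒ hulled
(INFL-4f reading). [folklore] -/
def ndNiO2M_tperp_members : List ℚ := [422/10000, 418/10000, 34/395, 33/374]

/-- **`tperp/t (M)` ROW OF RECORD as printed**: `[0.041, 0.088]` (§DFT-1b v1 / §OF-RECORD v1; fitted ⇒ no ×/÷2 floor). [folklore] -/
def ndNiO2M_tperp : Entry := Entry.ofEnds (41/1000) (11/125) (by norm_num) .screening

/-- The two in-house members and the Kitatani member lie in the printed row. [folklore] -/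
theorem ndNiO2M_tperp_members_mem_row_three :
    ndNiO2M_tperp.Mem ((422/10000 : ℚ) : ℝ) ∧ ndNiO2M_tperp.Mem ((418/10000 : ℚ) : ℝ) ∧ ndNiO2M_tperp.Mem ((34/395 : ℚ) : ℝ) :=
  ⟨Entry.mem_ofEnds_of_rat (by norm_num) (by norm_num), Entry.mem_ofEnds_of_rat (by norm_num) (by norm_num),
    Entry.mem_ofEnds_of_rat (by norm_num) (by norm_num)⟩

/-- **ROUNDING FINDING (ask R-xx, no edit here)**: the printed row end `0.088` does NOT enclose the admitted Been member `33/374 = 0.08824` (nor its own 4-decimal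
print `0.0882` in the §R-ac FOLD re-print «hull [0.0861, 0.0882]»): inward by `2.4·10⁻⁴`; outward 3-decimal print = `0.089`. Word-insensitive (D9 reads the 0.05
straddle and the antinode object). [folklore] -/
theorem ndNiO2M_tperp_row_misses_Been : ¬ ndNiO2M_tperp.Mem ((33/374 : ℚ) : ℝ) ∧ (11/125 : ℚ) < 33/374 ∧ (33/374 : ℚ) ≤ 89/1000 := by
  refine ⟨fun h => ?_, by norm_num, by norm_num⟩
  have h' := ((Entry.mem_ofEnds_iff _ _ _ _ _).1 h).2
  exact absurd h' (by norm_num)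

/-! ## §4 Quotient rows: `U/t (M)`, `r₁ = U/W₁`, `V/t`, `J = 4t²/U` -/

/-- **`U_abs` hull of record** `[2.47, 3.2]` eV (§R-ac FOLD v1 / §U-MEMBERS v1: edge members = in-house cRPA(W)@PBE 26-Ry rung 2.47 (CRPA-py:j266630+j263107) and
Kitatani 2020 p. 3 `3.2` «= 8t»; interior 2.578 / 2.608 Nomura 2019 Tab. III, 2.910 Hirayama 2022 Tab. 3, 3.10 in-house (D) j267003 — the members are TYPED in unc-2's
object-E ladder; only the hull ends are used here). [folklore] -/
def ndNiO2M_Uabs : Entry := Entry.ofEnds (247/100) (16/5) (by norm_num) .screening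

/-- **`U/t (M)` direct row** `[6.25, 8.68]` (§R-ac FOLD v1: `divPos([2.47, 3.2], [0.3689, 0.395]) = [6.2532, 8.6744]` outward). [folklore] -/
def ndNiO2M_UoverT_direct : Entry := Entry.ofEnds (25/4) (217/25) (by norm_num) .screening

/-- **`U/t (M)` ROW OF RECORD** `[5.82, 9.8]` (§R-ac FOLD v1: lo = min(2.47/0.4240 = 5.8253, provisional ±20 % INFL-3to1 edge 5.9710) outward; hi = 9.8 «R-B4,
3.2 ÷ t_B 0.326, never shrinks»). [folklore] -/
def ndNiO2M_UoverT : Entry := Entry.ofEnds (291/50) (49/5) (by norm_num) .screening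

/-- **Quotient enclosure, direct**: `U ∈ [2.47, 3.2]`, `t ∈ [0.3689, 0.395]` ⇒ `U/t ∈ [6.25, 8.68]`. [folklore] -/
theorem ndNiO2M_UoverT_direct_of_mem {U t : ℝ} (hU : ndNiO2M_Uabs.Mem U) (ht : ndNiO2M_t_direct.Mem t) :
    ndNiO2M_UoverT_direct.Mem (U / t) := by
  have hU' := (Entry.mem_ofEnds_iff _ _ _ _ _).1 hU
  have ht' := (Entry.mem_ofEnds_iff _ _ _ _ _).1 ht
  push_cast at hU' ht'
  obtain ⟨h1, h2⟩ := divPos_bounds (by norm_num) (by norm_num) hU' ht'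
  refine (Entry.mem_ofEnds_iff _ _ _ _ _).2 ⟨?_, ?_⟩ <;> push_cast
  · exact le_trans (by norm_num) h1
  · exact le_trans h2 (by norm_num)

/-- **Quotient enclosure into the printed ROW, and how far it reaches in `t`**: `U ∈ [2.47, 3.2]` and `t ∈ [16/49, 0.4240]` (`0.4240` = the `t` upper edge
implicit in the record's lower end, §R-ac FOLD v1; `16/49 = 3.2/9.8 = 0.32653…` = the smallest `t` the printed upper end `9.8` covers — NOT the technique-B
floor `0.326`, see `ndNiO2M_UoverT_row_misses_RB4_quotient`) ⇒ `U/t ∈ [5.82, 9.8]`. [folklore] -/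
theorem ndNiO2M_UoverT_of_mem {U t : ℝ} (hU : ndNiO2M_Uabs.Mem U) (ht : (16/49 : ℝ) ≤ t ∧ t ≤ 4240/10000) :
    ndNiO2M_UoverT.Mem (U / t) := by
  have hU' := (Entry.mem_ofEnds_iff _ _ _ _ _).1 hU
  push_cast at hU'
  obtain ⟨h1, h2⟩ := divPos_bounds (by norm_num) (by norm_num) hU' ht
  refine (Entry.mem_ofEnds_iff _ _ _ _ _).2 ⟨?_, ?_⟩ <;> push_cast
  · exact le_trans (by norm_num) h1
  · exact le_trans h2 (by norm_num)

/-- **ROUNDING FINDING (ask R-xx, no edit here)**: the defining quotient of the printed upper end, `3.2 / 0.326 = 1600/163 = 9.8159…` (R-B4), is NOT enclosed by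
the printed `9.8` (1-decimal inward print, by `0.016`); the 2-decimal outward print is `9.82`. Word-insensitive (`r₁` reads `W₁`, not `t`); S2 containment of box #1
(`U/t = 8 ± 0.5`) unaffected. [folklore] -/
theorem ndNiO2M_UoverT_row_misses_RB4_quotient :
    ¬ ndNiO2M_UoverT.Mem (((16/5 : ℚ) / (326/1000)) : ℝ) ∧ (49/5 : ℚ) < 16/5 / (326/1000) ∧ (16/5 : ℚ) / (326/1000) ≤ 982/100 := by
  refine ⟨fun h => ?_, by norm_num, by norm_num⟩
  have h' := ((Entry.mem_ofEnds_iff _ _ _ _ _).1 h).2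
  push_cast at h'
  norm_num at h'

/-- **`W₁` (fitted MLWF bandwidth incl. `k_z`, eV), column M21 hull** `[3.078, 3.128]` (WAN:j257807 p0 3.078, WAN:j257812 sto 3.128; D5/D7). [folklore] -/
def ndNiO2M_W1_M21 : Entry := Entry.ofEnds (3078/1000) (3128/1000) (by norm_num) .screening

/-- **`r₁ = U_abs / W₁` ROW, column M21** `[0.789, 1.04]` (§R-ac FOLD v1: `divPos = [0.7896, 1.0396]` outward). [folklore] -/
def ndNiO2M_r1_M21 : Entry := Entry.ofEnds (789/1000) (26/25) (by norm_num) .screening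

/-- **Quotient enclosure for `r₁`** and **the «1BH» word-bearing inequality with its margin**: `U ∈ [2.47, 3.2]`, `W₁ ∈ [3.078, 3.128]` ⇒ `r₁ = U/W₁ ∈ [0.789, 1.04]`
and `r₁ ≥ 3/5 = θ_hi` (ROUTER R3a ⇒ «1BH», no MIXED straddle), indeed `r₁ ≥ 0.789 = θ_hi + 0.189`. [folklore] -/
theorem ndNiO2M_r1_of_mem {U W : ℝ} (hU : ndNiO2M_Uabs.Mem U) (hW : ndNiO2M_W1_M21.Mem W) :
    ndNiO2M_r1_M21.Mem (U / W) ∧ (3 / 5 : ℝ) + 0.189 ≤ U / W := by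
  have hU' := (Entry.mem_ofEnds_iff _ _ _ _ _).1 hU
  have hW' := (Entry.mem_ofEnds_iff _ _ _ _ _).1 hW
  push_cast at hU' hW'
  obtain ⟨h1, h2⟩ := divPos_bounds (by norm_num) (by norm_num) hU' hW'
  refine ⟨(Entry.mem_ofEnds_iff _ _ _ _ _).2 ⟨?_, ?_⟩, le_trans (by norm_num) h1⟩ <;> push_cast
  · exact le_trans (by norm_num) h1
  · exact le_trans h2 (by norm_num)

/-- **Word robustness in `U`** (how far a NEW admitted `U` member could fall before «1BH» is at risk): at any `W₁ ≤ 3.128` eV, every `U ≥ 1.877` eV keeps `r₁ ≥ 3/5`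
— `0.59` eV below today's lowest member `2.47`. [folklore] -/
theorem ndNiO2M_r1_word_margin {U W : ℝ} (hU : (1877/1000 : ℝ) ≤ U) (hW : 0 < W ∧ W ≤ 3128/1000) : (3 / 5 : ℝ) ≤ U / W := by
  rw [le_div_iff₀ hW.1]
  nlinarith [hW.2]

/-- **`V/t` ROW OF RECORD** `[0.49, 0.67]` (§OF-RECORD v1: LIT `V_a = 0.218 / 0.223` eV, Nomura 2019 Tab. III, single scheme, over the `t` hull ⇒ `[0.552, 0.605]`;
FLOOR(V/t) ±15 % ⇒ midpoint `0.58 ± 0.087`). [folklore] -/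
def ndNiO2M_VoverT : Entry := Entry.ofEnds (49/100) (67/100) (by norm_num) .screening

/-- **Quotient enclosure for `V/t`**: `V ∈ [0.218, 0.223]` eV, `t` in the direct hull ⇒ `V/t ∈ [0.49, 0.67]` (indeed `∈ [0.5518, 0.6045]`). [folklore] -/
theorem ndNiO2M_VoverT_of_mem {V t : ℝ} (hV : (218/1000 : ℝ) ≤ V ∧ V ≤ 223/1000) (ht : ndNiO2M_t_direct.Mem t) :
    ndNiO2M_VoverT.Mem (V / t) := by
  have ht' := (Entry.mem_ofEnds_iff _ _ _ _ _).1 ht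
  push_cast at ht'
  obtain ⟨h1, h2⟩ := divPos_bounds (by norm_num) (by norm_num) hV ht'
  refine (Entry.mem_ofEnds_iff _ _ _ _ _).2 ⟨?_, ?_⟩ <;> push_cast
  · exact le_trans (by norm_num) h1
  · exact le_trans h2 (by norm_num)

/-- **`J = 4t²/U` DERIVED context** (never a box input): `t` in the direct hull, `U ∈ [2.47, 3.2]` eV ⇒ `0.170 ≤ 4t²/U ≤ 0.2527` eV (printed `[170, 253]` meV, §R-ac FOLD
v1), hence `≥ 2.5 ×` the RIXS upper value `J₁ ≤ 0.0641 + 0.0034` eV (Lu et al. Science 373 213 (2021) arXiv:2105.11300 p. 6 [float]) — the MODEL-FORM WARNING OF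
RECORD (mod-3 §A: no `J`-consistent sub-box inside the one-band hull; S3 uses `J_expt`). [folklore] -/
theorem ndNiO2M_J_context {t U : ℝ} (ht : ndNiO2M_t_direct.Mem t) (hU : ndNiO2M_Uabs.Mem U) :
    (0.170 : ℝ) ≤ 4 * t ^ 2 / U ∧ 4 * t ^ 2 / U ≤ 0.2527 ∧ 2.5 * (0.0641 + 0.0034) ≤ 4 * t ^ 2 / U := by
  have ht' := (Entry.mem_ofEnds_iff _ _ _ _ _).1 ht
  have hU' := (Entry.mem_ofEnds_iff _ _ _ _ _).1 hU
  push_cast at ht' hU'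
  have hU0 : 0 < U := by linarith [hU'.1]
  have ht0 : 0 ≤ t := by linarith [ht'.1]
  have hlo : (0.170 : ℝ) ≤ 4 * t ^ 2 / U := by
    rw [le_div_iff₀ hU0]; nlinarith [ht'.1, hU'.2]
  refine ⟨hlo, ?_, le_trans (by norm_num) hlo⟩
  rw [div_le_iff₀ hU0]; nlinarith [ht'.2, hU'.1]

end Summit.Ventures.CertifiedManyBodySolver.Downfold

end
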